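import Mathlib
import Summits.NavierStokesRegularity.NavierStokesRegularity.Theorems.EulerZoomLiouvillePowerGaugeEulerLiouvilleClassIsometry
import Literature.Analysis.FluidPDE.SelfSimilarCollapseAnsatz
import HarnessLib

/-!
# Crux `EulerZoomLiouville.PowerGaugeEulerLiouville` (stmt-NavierStokesRegularity-19832):
# the CLASS-LEVEL O(3) receipts — `InClass`, `IsExactlySelfSimilar`, `IsExtremalProfile`, `VanishesAE` are frame-invariant

Route №10 `EulerZoomLiouville` (NavierStokesRegularity), crux E, LEAD key W2-NSCOV (2026-08-29).  `…ClassIsometry` (p718442 and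
before) proves the FORWARD transport of the three crux binders under `u ↦ (τ,x) ↦ R u(τ,R⁻¹x)`, `p ↦ (τ,x) ↦ p(τ,R⁻¹x)`,
`H ↦ (τ,x) ↦ R ∘ H(τ,R⁻¹x) ∘ R⁻¹` (`isSuitableWeakSolutionOn_conj_isometry`, `hasWeakSpatialGradientOn_conj_isometry`,
`gauge_conj_isometry`).  This file records the EQUIVALENCES the skeleton cites («the `∃ R` clauses of THE ONE STATEMENT are the only
frame content left»), with the texts of skeleton v115 (`Cruxes/PowerGaugeEulerLiouville/Lines/birth.lean`) δ-unfolded binder for binder: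

* `inClass_conj` / `inClass_of_conj` / `inClass_conj_iff` — `InClass ρ u p H c` (suitable weak Euler on the past slab ∧ weak spatial
  gradient ∧ power gauges `≤ c` at every scale about the origin);
* `selfSimilarCollapse_conj`, `selfSimilarCollapsePressure_conj`, `isExactlySelfSimilar_conj` / `_of_conj` / `_conj_iff` —
  `IsExactlySelfSimilar ρ u p V P` with the conjugated profile `(y ↦ R V(R⁻¹y), y ↦ P(R⁻¹y))`;
* `setIntegral_ball_normSq_conj`, `isExtremalProfile_conj_iff` — `IsExtremalProfile ρ V` (the ball `B(0,L)` is `R`-invariant, `‖Rv‖ = ‖v‖`);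
* `vanishesAE_of_conj` / `vanishesAE_conj_iff` — the conclusion `uncurry u =ᵐ 0` on the past slab (pull back along the
  measure-preserving `(s,x) ↦ (s,Rx)`; the tail of `ClassIsometry.ae_eq_zero_of_conj`).

Each `_of_conj` is its `_conj` twin applied to `R⁻¹` and the involution `R⁻¹(R v) = v` (for `H`: `R⁻¹ ∘ (R ∘ A ∘ R⁻¹) ∘ R = A`,
`clm_symm_conj_conj`).  WHAT THIS IS NOT: not NS, not E, no stub of 19832 is closed — frame bookkeeping for the hypothetical Euler
zoom-limit class; the crux stays OPEN.  [cite: MajdaBertozziCUP2002, §1.2 Prop. 1.1 (iii); CaffarelliKohnNirenberg1982, §2]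
-/

noncomputable section

-- flat `Theorems/<Route><Decl>…` files of one crux share the namespace of the crux (tree convention)
set_option linter.dupNamespace false

open MeasureTheory Set Filter Topology Metric Function
open scoped NNReal ENNReal RealInnerProductSpace

namespace Summit.NavierStokesRegularity.NavierStokesRegularity.Theorems.PowerGaugeEulerLiouville.ClassIsometry

open Literature.Analysis Literature.Analysis.FluidPDE

variable (R : EuclideanSpace ℝ (Fin 3) ≃ₗᵢ[ℝ] EuclideanSpace ℝ (Fin 3))
  {u : ℝ → EuclideanSpace ℝ (Fin 3) → EuclideanSpace ℝ (Fin 3)} {p : ℝ → EuclideanSpace ℝ (Fin 3) → ℝ}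
  {H : ℝ → EuclideanSpace ℝ (Fin 3) → EuclideanSpace ℝ (Fin 3) →L[ℝ] EuclideanSpace ℝ (Fin 3)} {c : ℝ≥0}

/-! ### §0 Involution bookkeeping -/

/-- `R⁻¹ ∘ (R ∘ A ∘ R⁻¹) ∘ R = A` for continuous linear maps (conjugating a gradient forth and back). [folklore] -/
theorem clm_symm_conj_conj (A : EuclideanSpace ℝ (Fin 3) →L[ℝ] EuclideanSpace ℝ (Fin 3)) :
    (R.symm : EuclideanSpace ℝ (Fin 3) →L[ℝ] EuclideanSpace ℝ (Fin 3)).comp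
        ((((R : EuclideanSpace ℝ (Fin 3) →L[ℝ] EuclideanSpace ℝ (Fin 3)).comp
            (A.comp (R.symm : EuclideanSpace ℝ (Fin 3) →L[ℝ] EuclideanSpace ℝ (Fin 3))))).comp
          (R : EuclideanSpace ℝ (Fin 3) →L[ℝ] EuclideanSpace ℝ (Fin 3))) = A := by
  ext v i
  simp

/-- The conjugated zero force is the zero force: `(s,x) ↦ R (0 (s, R⁻¹x)) = 0`. [folklore] -/
theorem conj_zero_force :
    (fun (s : ℝ) (x : EuclideanSpace ℝ (Fin 3)) =>
      R ((0 : ℝ → EuclideanSpace ℝ (Fin 3) → EuclideanSpace ℝ (Fin 3)) s (R.symm x))) = 0 := by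
  funext s x
  simp

/-! ### §1 `InClass ρ u p H c` -/

/-- **`InClass` is covariant** (text of skeleton v115, δ-unfolded): the conjugated triple `(R u R⁻¹, p ∘ R⁻¹, R H R⁻¹ ∘ R⁻¹)` is again a
suitable weak Euler flow on the past slab with weak spatial gradient and the same power gauges `≤ c` about the origin.
[cite: CaffarelliKohnNirenberg1982, §2 eq. (2.1)-(2.6); MajdaBertozziCUP2002, §1.2 Prop. 1.1 (iii)] -/
theorem inClass_conj {ρ : ℝ}
    (h : IsSuitableWeakSolutionOn (slab (EuclideanSpace ℝ (Fin 3)) (Set.Iio 0) isOpen_Iio) 0 0 u p ∧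
      HasWeakSpatialGradientOn (slab (EuclideanSpace ℝ (Fin 3)) (Set.Iio 0) isOpen_Iio) u H ∧
      (∀ a : ℝ, 0 < a →
        ENNReal.ofReal (a ^ (2 * ρ)) * cknA a (0 : ℝ × EuclideanSpace ℝ (Fin 3)) u +
            ENNReal.ofReal (a ^ ρ) * cknE a (0 : ℝ × EuclideanSpace ℝ (Fin 3)) H +
          ENNReal.ofReal (a ^ (2 * ρ)) * cknD a (0 : ℝ × EuclideanSpace ℝ (Fin 3)) p ≤ (c : ℝ≥0∞))) :
    IsSuitableWeakSolutionOn (slab (EuclideanSpace ℝ (Fin 3)) (Set.Iio 0) isOpen_Iio) 0 0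
        (fun τ x => R (u τ (R.symm x))) (fun τ x => p τ (R.symm x)) ∧
      HasWeakSpatialGradientOn (slab (EuclideanSpace ℝ (Fin 3)) (Set.Iio 0) isOpen_Iio)
        (fun τ x => R (u τ (R.symm x)))
        (fun τ x => (R : EuclideanSpace ℝ (Fin 3) →L[ℝ] EuclideanSpace ℝ (Fin 3)).comp
          ((H τ (R.symm x)).comp (R.symm : EuclideanSpace ℝ (Fin 3) →L[ℝ] EuclideanSpace ℝ (Fin 3)))) ∧
      (∀ a : ℝ, 0 < a →
        ENNReal.ofReal (a ^ (2 * ρ)) * cknA a (0 : ℝ × EuclideanSpace ℝ (Fin 3)) (fun τ x => R (u τ (R.symm x))) +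
            ENNReal.ofReal (a ^ ρ) * cknE a (0 : ℝ × EuclideanSpace ℝ (Fin 3))
              (fun τ x => (R : EuclideanSpace ℝ (Fin 3) →L[ℝ] EuclideanSpace ℝ (Fin 3)).comp
                ((H τ (R.symm x)).comp (R.symm : EuclideanSpace ℝ (Fin 3) →L[ℝ] EuclideanSpace ℝ (Fin 3)))) +
          ENNReal.ofReal (a ^ (2 * ρ)) * cknD a (0 : ℝ × EuclideanSpace ℝ (Fin 3)) (fun τ x => p τ (R.symm x)) ≤
            (c : ℝ≥0∞)) := by
  obtain ⟨hsw, hH, hgauge⟩ := h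
  have h1 := isSuitableWeakSolutionOn_conj_isometry isOpen_Iio hsw R
  rw [conj_zero_force R] at h1
  exact ⟨h1, hasWeakSpatialGradientOn_conj_isometry isOpen_Iio hH R, gauge_conj_isometry R hgauge⟩

/-- **Converse**: membership of the conjugated triple gives membership of `(u, p, H)` (conjugate back with `R⁻¹`).
[cite: CaffarelliKohnNirenberg1982, §2 eq. (2.1)-(2.6); MajdaBertozziCUP2002, §1.2 Prop. 1.1 (iii)] -/
theorem inClass_of_conj {ρ : ℝ}
    (h : IsSuitableWeakSolutionOn (slab (EuclideanSpace ℝ (Fin 3)) (Set.Iio 0) isOpen_Iio) 0 0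
        (fun τ x => R (u τ (R.symm x))) (fun τ x => p τ (R.symm x)) ∧
      HasWeakSpatialGradientOn (slab (EuclideanSpace ℝ (Fin 3)) (Set.Iio 0) isOpen_Iio)
        (fun τ x => R (u τ (R.symm x)))
        (fun τ x => (R : EuclideanSpace ℝ (Fin 3) →L[ℝ] EuclideanSpace ℝ (Fin 3)).comp
          ((H τ (R.symm x)).comp (R.symm : EuclideanSpace ℝ (Fin 3) →L[ℝ] EuclideanSpace ℝ (Fin 3)))) ∧
      (∀ a : ℝ, 0 < a →
        ENNReal.ofReal (a ^ (2 * ρ)) * cknA a (0 : ℝ × EuclideanSpace ℝ (Fin 3)) (fun τ x => R (u τ (R.symm x))) +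
            ENNReal.ofReal (a ^ ρ) * cknE a (0 : ℝ × EuclideanSpace ℝ (Fin 3))
              (fun τ x => (R : EuclideanSpace ℝ (Fin 3) →L[ℝ] EuclideanSpace ℝ (Fin 3)).comp
                ((H τ (R.symm x)).comp (R.symm : EuclideanSpace ℝ (Fin 3) →L[ℝ] EuclideanSpace ℝ (Fin 3)))) +
          ENNReal.ofReal (a ^ (2 * ρ)) * cknD a (0 : ℝ × EuclideanSpace ℝ (Fin 3)) (fun τ x => p τ (R.symm x)) ≤
            (c : ℝ≥0∞))) :
    IsSuitableWeakSolutionOn (slab (EuclideanSpace ℝ (Fin 3)) (Set.Iio 0) isOpen_Iio) 0 0 u p ∧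
      HasWeakSpatialGradientOn (slab (EuclideanSpace ℝ (Fin 3)) (Set.Iio 0) isOpen_Iio) u H ∧
      (∀ a : ℝ, 0 < a →
        ENNReal.ofReal (a ^ (2 * ρ)) * cknA a (0 : ℝ × EuclideanSpace ℝ (Fin 3)) u +
            ENNReal.ofReal (a ^ ρ) * cknE a (0 : ℝ × EuclideanSpace ℝ (Fin 3)) H +
          ENNReal.ofReal (a ^ (2 * ρ)) * cknD a (0 : ℝ × EuclideanSpace ℝ (Fin 3)) p ≤ (c : ℝ≥0∞)) := by
  simpa only [LinearIsometryEquiv.symm_symm, LinearIsometryEquiv.symm_apply_apply, clm_symm_conj_conj] using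
    inClass_conj R.symm (u := fun τ x => R (u τ (R.symm x))) (p := fun τ x => p τ (R.symm x))
      (H := fun τ x => (R : EuclideanSpace ℝ (Fin 3) →L[ℝ] EuclideanSpace ℝ (Fin 3)).comp
        ((H τ (R.symm x)).comp (R.symm : EuclideanSpace ℝ (Fin 3) →L[ℝ] EuclideanSpace ℝ (Fin 3)))) h

/-- **`InClass ρ u p H c` is frame-invariant** (both directions). [cite: CaffarelliKohnNirenberg1982, §2; MajdaBertozziCUP2002, §1.2 Prop. 1.1 (iii)] -/
theorem inClass_conj_iff {ρ : ℝ} :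
    (IsSuitableWeakSolutionOn (slab (EuclideanSpace ℝ (Fin 3)) (Set.Iio 0) isOpen_Iio) 0 0
        (fun τ x => R (u τ (R.symm x))) (fun τ x => p τ (R.symm x)) ∧
      HasWeakSpatialGradientOn (slab (EuclideanSpace ℝ (Fin 3)) (Set.Iio 0) isOpen_Iio)
        (fun τ x => R (u τ (R.symm x)))
        (fun τ x => (R : EuclideanSpace ℝ (Fin 3) →L[ℝ] EuclideanSpace ℝ (Fin 3)).comp
          ((H τ (R.symm x)).comp (R.symm : EuclideanSpace ℝ (Fin 3) →L[ℝ] EuclideanSpace ℝ (Fin 3)))) ∧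
      (∀ a : ℝ, 0 < a →
        ENNReal.ofReal (a ^ (2 * ρ)) * cknA a (0 : ℝ × EuclideanSpace ℝ (Fin 3)) (fun τ x => R (u τ (R.symm x))) +
            ENNReal.ofReal (a ^ ρ) * cknE a (0 : ℝ × EuclideanSpace ℝ (Fin 3))
              (fun τ x => (R : EuclideanSpace ℝ (Fin 3) →L[ℝ] EuclideanSpace ℝ (Fin 3)).comp
                ((H τ (R.symm x)).comp (R.symm : EuclideanSpace ℝ (Fin 3) →L[ℝ] EuclideanSpace ℝ (Fin 3)))) +
          ENNReal.ofReal (a ^ (2 * ρ)) * cknD a (0 : ℝ × EuclideanSpace ℝ (Fin 3)) (fun τ x => p τ (R.symm x)) ≤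
            (c : ℝ≥0∞))) ↔
    (IsSuitableWeakSolutionOn (slab (EuclideanSpace ℝ (Fin 3)) (Set.Iio 0) isOpen_Iio) 0 0 u p ∧
      HasWeakSpatialGradientOn (slab (EuclideanSpace ℝ (Fin 3)) (Set.Iio 0) isOpen_Iio) u H ∧
      (∀ a : ℝ, 0 < a →
        ENNReal.ofReal (a ^ (2 * ρ)) * cknA a (0 : ℝ × EuclideanSpace ℝ (Fin 3)) u +
            ENNReal.ofReal (a ^ ρ) * cknE a (0 : ℝ × EuclideanSpace ℝ (Fin 3)) H +
          ENNReal.ofReal (a ^ (2 * ρ)) * cknD a (0 : ℝ × EuclideanSpace ℝ (Fin 3)) p ≤ (c : ℝ≥0∞))) :=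
  ⟨inClass_of_conj R, inClass_conj R⟩

/-! ### §2 `IsExactlySelfSimilar ρ u p V P` -/

/-- The self-similar collapse ansatz commutes with conjugation: `R (V_γ(τ, R⁻¹x)) = (R V R⁻¹)_γ(τ, x)`
(`selfSimilarCollapse γ 0 V τ x = (−τ)^{γ−1} V((−τ)^{−γ} x)`; `R`, `R⁻¹` are linear). [cite: ConstantinIgnatovaVicol2026Putative, §3.1 eq. (3.2)] -/
theorem selfSimilarCollapse_conj (γ : ℝ) (V : EuclideanSpace ℝ (Fin 3) → EuclideanSpace ℝ (Fin 3)) (τ : ℝ) :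
    (fun x => R (selfSimilarCollapse γ 0 V τ (R.symm x))) =
      selfSimilarCollapse γ 0 (fun y => R (V (R.symm y))) τ := by
  funext x
  simp only [selfSimilarCollapse_apply, map_smul]

/-- The pressure ansatz commutes with composition on the right: `P_γ(τ, R⁻¹x) = (P ∘ R⁻¹)_γ(τ, x)`.
[cite: ConstantinIgnatovaVicol2026Putative, §3.1 eq. (3.2)] -/
theorem selfSimilarCollapsePressure_conj (γ : ℝ) (P : EuclideanSpace ℝ (Fin 3) → ℝ) (τ : ℝ) :
    (fun x => selfSimilarCollapsePressure γ 0 P τ (R.symm x)) =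
      selfSimilarCollapsePressure γ 0 (fun y => P (R.symm y)) τ := by
  funext x
  simp only [selfSimilarCollapsePressure_apply, LinearIsometryEquiv.map_smul]

/-- **`IsExactlySelfSimilar` is covariant** (text of skeleton v115, δ-unfolded): if `(u,p)` is the exact `γ = 1/(2+ρ)` collapse of
the profile `(V, P)` on the open past, the conjugated pair is the collapse of `(R V R⁻¹, P ∘ R⁻¹)`.
[cite: ConstantinIgnatovaVicol2026Putative, §3.1 eq. (3.2); MajdaBertozziCUP2002, §1.2 Prop. 1.1 (iii)] -/
theorem isExactlySelfSimilar_conj {ρ : ℝ} {V : EuclideanSpace ℝ (Fin 3) → EuclideanSpace ℝ (Fin 3)}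
    {P : EuclideanSpace ℝ (Fin 3) → ℝ}
    (h : (∀ τ : ℝ, τ < 0 → u τ = selfSimilarCollapse (1 / (2 + ρ)) 0 V τ) ∧
      (∀ τ : ℝ, τ < 0 → p τ = selfSimilarCollapsePressure (1 / (2 + ρ)) 0 P τ)) :
    (∀ τ : ℝ, τ < 0 →
        (fun τ x => R (u τ (R.symm x))) τ = selfSimilarCollapse (1 / (2 + ρ)) 0 (fun y => R (V (R.symm y))) τ) ∧
      (∀ τ : ℝ, τ < 0 →
        (fun τ x => p τ (R.symm x)) τ = selfSimilarCollapsePressure (1 / (2 + ρ)) 0 (fun y => P (R.symm y)) τ) := by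
  refine ⟨fun τ hτ => ?_, fun τ hτ => ?_⟩
  · rw [← selfSimilarCollapse_conj R, ← h.1 τ hτ]
  · rw [← selfSimilarCollapsePressure_conj R, ← h.2 τ hτ]

/-- **Converse** (conjugate back with `R⁻¹`). [cite: ConstantinIgnatovaVicol2026Putative, §3.1 eq. (3.2); MajdaBertozziCUP2002, §1.2 Prop. 1.1 (iii)] -/
theorem isExactlySelfSimilar_of_conj {ρ : ℝ} {V : EuclideanSpace ℝ (Fin 3) → EuclideanSpace ℝ (Fin 3)}
    {P : EuclideanSpace ℝ (Fin 3) → ℝ}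
    (h : (∀ τ : ℝ, τ < 0 →
        (fun τ x => R (u τ (R.symm x))) τ = selfSimilarCollapse (1 / (2 + ρ)) 0 (fun y => R (V (R.symm y))) τ) ∧
      (∀ τ : ℝ, τ < 0 →
        (fun τ x => p τ (R.symm x)) τ = selfSimilarCollapsePressure (1 / (2 + ρ)) 0 (fun y => P (R.symm y)) τ)) :
    (∀ τ : ℝ, τ < 0 → u τ = selfSimilarCollapse (1 / (2 + ρ)) 0 V τ) ∧
      (∀ τ : ℝ, τ < 0 → p τ = selfSimilarCollapsePressure (1 / (2 + ρ)) 0 P τ) := by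
  simpa only [LinearIsometryEquiv.symm_symm, LinearIsometryEquiv.symm_apply_apply] using
    isExactlySelfSimilar_conj R.symm (u := fun τ x => R (u τ (R.symm x))) (p := fun τ x => p τ (R.symm x))
      (V := fun y => R (V (R.symm y))) (P := fun y => P (R.symm y)) h

/-- **`IsExactlySelfSimilar ρ` is frame-invariant** (both directions, profile conjugated along).
[cite: ConstantinIgnatovaVicol2026Putative, §3.1 eq. (3.2); MajdaBertozziCUP2002, §1.2 Prop. 1.1 (iii)] -/
theorem isExactlySelfSimilar_conj_iff {ρ : ℝ} {V : EuclideanSpace ℝ (Fin 3) → EuclideanSpace ℝ (Fin 3)}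
    {P : EuclideanSpace ℝ (Fin 3) → ℝ} :
    ((∀ τ : ℝ, τ < 0 →
        (fun τ x => R (u τ (R.symm x))) τ = selfSimilarCollapse (1 / (2 + ρ)) 0 (fun y => R (V (R.symm y))) τ) ∧
      (∀ τ : ℝ, τ < 0 →
        (fun τ x => p τ (R.symm x)) τ = selfSimilarCollapsePressure (1 / (2 + ρ)) 0 (fun y => P (R.symm y)) τ)) ↔
    ((∀ τ : ℝ, τ < 0 → u τ = selfSimilarCollapse (1 / (2 + ρ)) 0 V τ) ∧
      (∀ τ : ℝ, τ < 0 → p τ = selfSimilarCollapsePressure (1 / (2 + ρ)) 0 P τ)) :=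
  ⟨isExactlySelfSimilar_of_conj R, isExactlySelfSimilar_conj R⟩

/-! ### §3 `IsExtremalProfile ρ V` -/

/-- Ball energies are invariant: `∫_{B(0,L)} ‖R V(R⁻¹y)‖² dy = ∫_{B(0,L)} ‖V‖²` (`‖Rv‖ = ‖v‖`, `R⁻¹ B(0,L) = B(0,L)`, `R⁻¹` volume
preserving). [folklore] -/
theorem setIntegral_ball_normSq_conj (V : EuclideanSpace ℝ (Fin 3) → EuclideanSpace ℝ (Fin 3)) (L : ℝ) :
    ∫ y in ball (0 : EuclideanSpace ℝ (Fin 3)) L, ‖R (V (R.symm y))‖ ^ 2 =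
      ∫ y in ball (0 : EuclideanSpace ℝ (Fin 3)) L, ‖V y‖ ^ 2 := by
  simp_rw [LinearIsometryEquiv.norm_map]
  have hpre : (R.symm : EuclideanSpace ℝ (Fin 3) → EuclideanSpace ℝ (Fin 3)) ⁻¹'
      ball (0 : EuclideanSpace ℝ (Fin 3)) L = ball 0 L := by
    rw [R.symm.preimage_ball, R.symm_symm, map_zero]
  have h1 := R.symm.measurePreserving.setIntegral_preimage_emb R.symm.toHomeomorph.measurableEmbedding
    (fun y => ‖V y‖ ^ 2) (ball (0 : EuclideanSpace ℝ (Fin 3)) L)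
  rw [hpre] at h1
  exact h1

/-- **`IsExtremalProfile ρ` is frame-invariant** (text of skeleton v115, δ-unfolded): extremal energy growth
`ε ≤ L^{2ρ−1}∫_{B(0,L)}|V|²` for large `L` holds for `R V R⁻¹` iff for `V`. [folklore] -/
theorem isExtremalProfile_conj_iff {ρ : ℝ} {V : EuclideanSpace ℝ (Fin 3) → EuclideanSpace ℝ (Fin 3)} :
    (∃ ε : ℝ, 0 < ε ∧ ∃ L₀ : ℝ, ∀ L : ℝ, L₀ ≤ L →
        ε ≤ L ^ (2 * ρ - 1) * ∫ y in ball (0 : EuclideanSpace ℝ (Fin 3)) L, ‖R (V (R.symm y))‖ ^ 2) ↔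
      ∃ ε : ℝ, 0 < ε ∧ ∃ L₀ : ℝ, ∀ L : ℝ, L₀ ≤ L →
        ε ≤ L ^ (2 * ρ - 1) * ∫ y in ball (0 : EuclideanSpace ℝ (Fin 3)) L, ‖V y‖ ^ 2 := by
  simp_rw [setIntegral_ball_normSq_conj R V]

/-! ### §4 The conclusion `VanishesAE u` -/

/-- **A.e. vanishing on the past slab pulls back along the conjugation**: if `R u(·, R⁻¹·) = 0` a.e. on `(−∞,0) × ℝ³`, then `u = 0`
a.e. there (`(s,x) ↦ (s,Rx)` preserves the restricted Lebesgue measure). [folklore] -/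
theorem vanishesAE_of_conj
    (h : uncurry (fun τ x => R (u τ (R.symm x))) =ᵐ[volume.restrict
      (Set.Iio (0 : ℝ) ×ˢ (univ : Set (EuclideanSpace ℝ (Fin 3))))] 0) :
    uncurry u =ᵐ[volume.restrict (Set.Iio (0 : ℝ) ×ˢ (univ : Set (EuclideanSpace ℝ (Fin 3))))] 0 := by
  -- the tail of `ClassIsometry.ae_eq_zero_of_conj` (ns-ezl-w1 g10), verbatim
  set Ψ : ℝ × EuclideanSpace ℝ (Fin 3) → ℝ × EuclideanSpace ℝ (Fin 3) := fun z => (z.1, R z.2) with hΨ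
  have hΨmp : MeasurePreserving Ψ
      (volume.restrict (Set.Iio (0 : ℝ) ×ˢ (univ : Set (EuclideanSpace ℝ (Fin 3)))))
      (volume.restrict (Set.Iio (0 : ℝ) ×ˢ (univ : Set (EuclideanSpace ℝ (Fin 3))))) := by
    have h1 := (PressureSlaving.measurePreserving_prod_isometry R).restrict_preimage_emb
      (PressureSlaving.measurableEmbedding_prod_isometry R)
      (Set.Iio (0 : ℝ) ×ˢ (univ : Set (EuclideanSpace ℝ (Fin 3))))
    rwa [PressureSlaving.preimage_prod_isometry_slab] at h1
  have h2 : ∀ᵐ z ∂(volume.restrict (Set.Iio (0 : ℝ) ×ˢ (univ : Set (EuclideanSpace ℝ (Fin 3))))),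
      uncurry (fun s x => R (u s (R.symm x))) (Ψ z) =
        (0 : ℝ × EuclideanSpace ℝ (Fin 3) → EuclideanSpace ℝ (Fin 3)) (Ψ z) :=
    hΨmp.quasiMeasurePreserving.tendsto_ae.eventually h
  filter_upwards [h2] with z hz
  have hz' : R (u z.1 z.2) = 0 := by simpa [hΨ, uncurry] using hz
  show u z.1 z.2 = 0
  simpa using hz'

/-- **The conclusion of the crux is frame-invariant**: `R u(·,R⁻¹·) = 0` a.e. on the past slab iff `u = 0` a.e. there. [folklore] -/
theorem vanishesAE_conj_iff :
    uncurry (fun τ x => R (u τ (R.symm x))) =ᵐ[volume.restrict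
        (Set.Iio (0 : ℝ) ×ˢ (univ : Set (EuclideanSpace ℝ (Fin 3))))] 0 ↔
      uncurry u =ᵐ[volume.restrict (Set.Iio (0 : ℝ) ×ˢ (univ : Set (EuclideanSpace ℝ (Fin 3))))] 0 := by
  refine ⟨vanishesAE_of_conj R, fun h => ?_⟩
  have h' := vanishesAE_of_conj R.symm (u := fun τ x => R (u τ (R.symm x)))
  simp only [LinearIsometryEquiv.symm_symm, LinearIsometryEquiv.symm_apply_apply] at h'
  exact h' h

end Summit.NavierStokesRegularity.NavierStokesRegularity.Theorems.PowerGaugeEulerLiouville.ClassIsometry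

end
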